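import Summits.ValiantsHypothesis.ValiantsHypothesis.Theorems.BarrierLeverChowBenchmarkPairsGeneralNoGo

/-!
# Route BarrierLever — item 22038 `ChowBenchmarkPairs`, line `moore-peel`: the ZEON-ORTHOGONAL-DIFFERENCES no-go
# (general point tables; unifies the parallel-edge rule R1, the twisted-rectangle rule R2 and a new top-bits rule)

Helper file (`--supports stmt-ValiantsHypothesis-22038`; cell valiant-natproofs, rung V4, 𝒟-side benchmark of record; seat val-np-p4
gen 20; third of the no-go files `…ChowBenchmarkPairsHyperplane` (p633941), `…ChowBenchmarkPairsGeneralNoGo` (p634512)).  Closes NO item.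

THE RULE.  Let `P` be any point table and `p₁, p₂, p₃, p₄` four points with `{p₁,p₂} ∩ {p₃,p₄} = ∅`, `p₁ ≠ p₂`, `p₃ ≠ p₄`; put
`δ = P p₂ − P p₁`, `δ' = P p₄ − P p₃`.  If the two differences are ZEON-ORTHOGONAL on the benchmark columns —
`δ_c δ'_{c'} + δ_{c'} δ'_c = 0` for every pair of distinct coordinates `c ≠ c'` lying together in some column `T_j` (a binary code `< r`) —
then `row{p₁,p₃} − row{p₁,p₄} − row{p₂,p₃} + row{p₂,p₄} = 0` and the segment-moment matrix is singular
(`det_segMatrix_eq_zero_of_orthogonal_differences`, `det_eq_zero_of_orthogonal_differences`).  Special cases: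
(R1) both differences parallel to one axis `e_u` (`det_eq_zero_of_parallel_coordinate_edges` of p634512); (R2, twisted rectangles of the 0/1
no-go p630040, now for arbitrary tables) `δ = αe_u + βe_v`, `δ' = γe_u + εe_v` with `αε + βγ = 0`; (NEW) both differences supported on two
coordinates `u, v` that never occur together in a column — e.g. the top two bits when `y_{k−1}y_{k−2}` is not a column (`r < 3·2^{k−2}`): then
ANY two pairs of points differing only in those two coordinates kill the table (`det_eq_zero_of_differences_on_uncoupled_bits`).

MECHANISM.  In the zeon algebra `(R₂ − R₁)(R₄ − R₃) = R₁R₂R₃R₄·L_δ L_{δ'}` and `L_δ L_{δ'} = Σ_{c<c'} (δ_cδ'_{c'} + δ_{c'}δ'_c) y_c y_{c'}`; a monomial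
`y_c y_{c'}` that is not below any column contributes nothing to the benchmark coefficients.  Formally (polynomial ring, truncated inverses `t_a`
of …ChowCubeThetaHat, `t_a A_a ≡ 1` on squarefree coefficients): the alternating sum of the four pair products is `t₁t₂t₃t₄·(A₂−A₁)(A₄−A₃)`
(`pairSum_orthogonal_differences`), whose squarefree coefficients are the symmetrised double sums `double_sum_eq_zero`.

WHAT THIS IS NOT: a constraint on witnesses of the ∀h stubs only; no stub of the line is closed; nothing on items 20172 / 19717, crux
stmt-ValiantsHypothesis-14610, or `VP` versus `VNP`.
-/

set_option linter.dupNamespace false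

namespace Summit.ValiantsHypothesis.ValiantsHypothesis.Theorems.BarrierLever.ChowBenchmarkHyperplane

open Finset MvPolynomial
open Summit.ValiantsHypothesis.ValiantsHypothesis.Theorems.BarrierLever.MoorePeel (benchCols)
open Summit.ValiantsHypothesis.ValiantsHypothesis.Theorems.BarrierLever.ChowFactor (coeff_partitionExpo_mul_affineY)

variable {h : ℕ}

noncomputable section

/-! ## 1. Linear `y`-forms and the symmetrised double sum -/

/-- The linear `y`-form `Σ_c δ_c y_c`. -/
def linY (δ : Fin h → ℂ) : MvPolynomial (Fin (h + h)) ℂ := ∑ c, C (δ c) * X (Fin.natAdd h c)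

/-- Squarefree coefficients of `F · Σ_c δ_c y_c`: `Σ_{c∈T} δ_c · coeff (E ∅ (T∖c)) F`. -/
theorem coeff_mul_linY (F : MvPolynomial (Fin (h + h)) ℂ) (δ : Fin h → ℂ) (T : Finset (Fin h)) :
    coeff (expo0 T) (F * linY δ) = ∑ c ∈ T, δ c * coeff (expo0 (T.erase c)) F := by
  classical
  have e : F * linY δ = F * (1 + ∑ c, C (δ c) * X (Fin.natAdd h c)) - F := by unfold linY; ring
  rw [e, coeff_sub]
  unfold expo0
  rw [coeff_partitionExpo_mul_affineY F δ ∅ T]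
  ring

/-- The difference of two affine forms is the linear form of the difference of the points. -/
theorem affY_sub_affY (q : Fin h → Fin h → ℂ) (a b : Fin h) :
    affY q b - affY q a = linY (fun c => q b c - q a c) := by
  unfold affY linY
  rw [add_sub_add_left_eq_sub, ← Finset.sum_sub_distrib]
  refine Finset.sum_congr rfl fun c _ => ?_
  rw [C_sub, sub_mul]

/-- Squarefree coefficients of `G · L_δ · L_{δ'}` as a double sum over ordered pairs of distinct coordinates of the column. -/
theorem coeff_mul_linY_mul_linY (G : MvPolynomial (Fin (h + h)) ℂ) (δ δ' : Fin h → ℂ) (T : Finset (Fin h)) :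
    coeff (expo0 T) (G * linY δ * linY δ') =
      ∑ c' ∈ T, ∑ c ∈ T.erase c', δ c * δ' c' * coeff (expo0 ((T.erase c').erase c)) G := by
  rw [coeff_mul_linY]
  refine Finset.sum_congr rfl fun c' _ => ?_
  rw [coeff_mul_linY, Finset.mul_sum]
  refine Finset.sum_congr rfl fun c _ => ?_
  ring

/-- The symmetrised double sum vanishes when `δ_cδ'_{c'} + δ_{c'}δ'_c = 0` for all distinct `c, c'` in the column. -/
theorem double_sum_eq_zero (T : Finset (Fin h)) (g : Finset (Fin h) → ℂ) (δ δ' : Fin h → ℂ)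
    (hyp : ∀ c ∈ T, ∀ c' ∈ T, c ≠ c' → δ c * δ' c' + δ c' * δ' c = 0) :
    ∑ c' ∈ T, ∑ c ∈ T.erase c', δ c * δ' c' * g ((T.erase c').erase c) = 0 := by
  classical
  set S := ∑ c' ∈ T, ∑ c ∈ T.erase c', δ c * δ' c' * g ((T.erase c').erase c) with hS
  have hswap : S = ∑ c ∈ T, ∑ c' ∈ T.erase c, δ c * δ' c' * g ((T.erase c').erase c) := by
    rw [hS]
    refine Finset.sum_comm' (fun a b => ?_)
    simp only [Finset.mem_erase]
    constructor
    · rintro ⟨ha, hba, hb⟩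
      exact ⟨⟨fun e => hba e.symm, ha⟩, hb⟩
    · rintro ⟨⟨hab, ha⟩, hb⟩
      exact ⟨ha, fun e => hab e.symm, hb⟩
  have h2 : S + S = 0 := by
    nth_rewrite 2 [hswap]
    rw [hS, ← Finset.sum_add_distrib]
    refine Finset.sum_eq_zero fun x hx => ?_
    rw [← Finset.sum_add_distrib]
    refine Finset.sum_eq_zero fun y hy => ?_
    have hne : y ≠ x := (Finset.mem_erase.mp hy).1
    have hyT : y ∈ T := (Finset.mem_erase.mp hy).2
    rw [Finset.erase_right_comm (a := x) (b := y), ← add_mul, hyp y hyT x hx hne, zero_mul]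
  have : (2 : ℂ) * S = 0 := by rw [two_mul]; exact h2
  exact (mul_eq_zero.mp this).resolve_left two_ne_zero

/-! ## 2. The four-point identity -/

/-- **Zeon-orthogonal differences.**  With `δ = q p₂ − q p₁`, `δ' = q p₄ − q p₃`, if `δ_cδ'_{c'} + δ_{c'}δ'_c = 0` for all distinct
`c, c' ∈ T`, then `pairSum q p₁ p₃ T − pairSum q p₁ p₄ T − pairSum q p₂ p₃ T + pairSum q p₂ p₄ T = 0`. -/
theorem pairSum_orthogonal_differences (q : Fin h → Fin h → ℂ) {p₁ p₂ p₃ p₄ : Fin h}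
    (h13 : p₁ ≠ p₃) (h14 : p₁ ≠ p₄) (h23 : p₂ ≠ p₃) (h24 : p₂ ≠ p₄) (T : Finset (Fin h))
    (hyp : ∀ c ∈ T, ∀ c' ∈ T, c ≠ c' →
      (q p₂ c - q p₁ c) * (q p₄ c' - q p₃ c') + (q p₂ c' - q p₁ c') * (q p₄ c - q p₃ c) = 0) :
    pairSum q p₁ p₃ T - pairSum q p₁ p₄ T - pairSum q p₂ p₃ T + pairSum q p₂ p₄ T = 0 := by
  classical
  have key : coeff (expo0 T) (tinvPoly q p₁ * tinvPoly q p₃) - coeff (expo0 T) (tinvPoly q p₁ * tinvPoly q p₄)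
      - coeff (expo0 T) (tinvPoly q p₂ * tinvPoly q p₃) + coeff (expo0 T) (tinvPoly q p₂ * tinvPoly q p₄) = 0 := by
    have e13 : coeff (expo0 T) (tinvPoly q p₁ * tinvPoly q p₃) = coeff (expo0 T)
        (tinvPoly q p₁ * tinvPoly q p₃ * (tinvPoly q p₂ * affY q p₂) * (tinvPoly q p₄ * affY q p₄)) := by
      rw [coeff_mul_tinv_affY, coeff_mul_tinv_affY]
    have e14 : coeff (expo0 T) (tinvPoly q p₁ * tinvPoly q p₄) = coeff (expo0 T)
        (tinvPoly q p₁ * tinvPoly q p₄ * (tinvPoly q p₂ * affY q p₂) * (tinvPoly q p₃ * affY q p₃)) := by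
      rw [coeff_mul_tinv_affY, coeff_mul_tinv_affY]
    have e23 : coeff (expo0 T) (tinvPoly q p₂ * tinvPoly q p₃) = coeff (expo0 T)
        (tinvPoly q p₂ * tinvPoly q p₃ * (tinvPoly q p₁ * affY q p₁) * (tinvPoly q p₄ * affY q p₄)) := by
      rw [coeff_mul_tinv_affY, coeff_mul_tinv_affY]
    have e24 : coeff (expo0 T) (tinvPoly q p₂ * tinvPoly q p₄) = coeff (expo0 T)
        (tinvPoly q p₂ * tinvPoly q p₄ * (tinvPoly q p₁ * affY q p₁) * (tinvPoly q p₃ * affY q p₃)) := by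
      rw [coeff_mul_tinv_affY, coeff_mul_tinv_affY]
    rw [e13, e14, e23, e24, ← coeff_sub, ← coeff_sub, ← coeff_add]
    have e : (tinvPoly q p₁ * tinvPoly q p₃ * (tinvPoly q p₂ * affY q p₂) * (tinvPoly q p₄ * affY q p₄) -
        tinvPoly q p₁ * tinvPoly q p₄ * (tinvPoly q p₂ * affY q p₂) * (tinvPoly q p₃ * affY q p₃) -
        tinvPoly q p₂ * tinvPoly q p₃ * (tinvPoly q p₁ * affY q p₁) * (tinvPoly q p₄ * affY q p₄) +
        tinvPoly q p₂ * tinvPoly q p₄ * (tinvPoly q p₁ * affY q p₁) * (tinvPoly q p₃ * affY q p₃) :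
          MvPolynomial (Fin (h + h)) ℂ) =
        (tinvPoly q p₁ * tinvPoly q p₂ * tinvPoly q p₃ * tinvPoly q p₄) * (affY q p₂ - affY q p₁) *
          (affY q p₄ - affY q p₃) := by
      ring
    rw [e, affY_sub_affY, affY_sub_affY, coeff_mul_linY_mul_linY]
    exact double_sum_eq_zero T
      (fun S => coeff (expo0 S) (tinvPoly q p₁ * tinvPoly q p₂ * tinvPoly q p₃ * tinvPoly q p₄))
      (fun c => q p₂ c - q p₁ c) (fun c => q p₄ c - q p₃ c) hyp
  rw [coeff_tinv_mul_tinv q h13, coeff_tinv_mul_tinv q h14, coeff_tinv_mul_tinv q h23, coeff_tinv_mul_tinv q h24] at key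
  have hu : ((-1 : ℂ) ^ T.card) ≠ 0 := pow_ne_zero _ (by norm_num)
  have : (-1 : ℂ) ^ T.card *
      (pairSum q p₁ p₃ T - pairSum q p₁ p₄ T - pairSum q p₂ p₃ T + pairSum q p₂ p₄ T) = 0 := by
    rw [← key]; ring
  exact (mul_eq_zero.mp this).resolve_left hu

/-! ## 3. The no-go's -/

/-- **A rectangle relation among four pair rows kills the matrix** (abstract form of the kernel-vector argument): if at every column
`pairSum x b + pairSum x' b' = pairSum x b' + pairSum x' b` for points `x ≠ x'`, `b ≠ b'`, `{x,x'} ∩ {b,b'} = ∅`, then `det = 0`. -/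
theorem det_segMatrix_eq_zero_of_rectangle_relation {r : ℕ} (P : Fin h → Fin h → ℂ) (x x' b b' : Fin h)
    (hxx' : x ≠ x') (hbb' : b ≠ b') (hxb : x ≠ b) (hxb' : x ≠ b') (hx'b : x' ≠ b) (hx'b' : x' ≠ b')
    (hrel : ∀ T : Finset (Fin h), pairSum P x b T + pairSum P x' b' T - pairSum P x b' T - pairSum P x' b T = 0)
    (uu : Fin r → Finset (Fin h)) (hsurj : ∀ S : Finset (Fin h), S.card ≤ 2 → ∃ i, uu i = S) :
    (segMatrix r P uu).det = 0 := by
  classical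
  set M := segMatrix r P uu with hM
  have card2 : ∀ p q : Fin h, p ≠ q → ({p, q} : Finset (Fin h)).card ≤ 2 := fun p q hpq => by
    rw [Finset.card_pair hpq]
  obtain ⟨i₁, hi₁⟩ := hsurj {x, b} (card2 x b hxb)
  obtain ⟨i₂, hi₂⟩ := hsurj {x', b'} (card2 x' b' hx'b')
  obtain ⟨i₃, hi₃⟩ := hsurj {x, b'} (card2 x b' hxb')
  obtain ⟨i₄, hi₄⟩ := hsurj {x', b} (card2 x' b hx'b)
  have n12 : i₁ ≠ i₂ := by
    intro e; rcases pair_eq_pair_iff x b x' b' (by rw [← hi₁, ← hi₂, e]) with ⟨h1, _⟩ | ⟨h1, _⟩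
    · exact hxx' h1
    · exact hxb' h1
  have n13 : i₁ ≠ i₃ := by
    intro e; rcases pair_eq_pair_iff x b x b' (by rw [← hi₁, ← hi₃, e]) with ⟨_, h2⟩ | ⟨h1, _⟩
    · exact hbb' h2
    · exact hxb' h1
  have n14 : i₁ ≠ i₄ := by
    intro e; rcases pair_eq_pair_iff x b x' b (by rw [← hi₁, ← hi₄, e]) with ⟨h1, _⟩ | ⟨h1, _⟩
    · exact hxx' h1
    · exact hxb h1
  let v : Fin r → ℂ := Pi.single i₁ 1 + Pi.single i₂ 1 - Pi.single i₃ 1 - Pi.single i₄ 1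
  have hv0 : v ≠ 0 := by
    intro hv
    have := congr_fun hv i₁
    simp only [v, Pi.add_apply, Pi.sub_apply, Pi.single_eq_same, Pi.single_eq_of_ne n12, Pi.single_eq_of_ne n13,
      Pi.single_eq_of_ne n14, Pi.zero_apply] at this
    norm_num at this
  have hvM : Matrix.vecMul v M = 0 := by
    funext j
    simp only [v, Matrix.add_vecMul, Matrix.sub_vecMul, Matrix.single_one_vecMul, Pi.add_apply, Pi.sub_apply,
      Matrix.row_apply, Pi.zero_apply]
    rw [hM, segMatrix_row_pair P uu hxb hi₁ j, segMatrix_row_pair P uu hx'b' hi₂ j, segMatrix_row_pair P uu hxb' hi₃ j,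
      segMatrix_row_pair P uu hx'b hi₄ j]
    exact hrel (benchCols h r j)
  exact (Matrix.exists_vecMul_eq_zero_iff).mp ⟨v, hv0, hvM⟩

/-- **Zeon-orthogonal differences kill every table (matrix form).**  Four points `p₁ ≠ p₂`, `p₃ ≠ p₄`, `{p₁,p₂} ∩ {p₃,p₄} = ∅`;
if for every benchmark column `T_j` and all distinct `c, c' ∈ T_j`:
`(P p₂ c − P p₁ c)(P p₄ c' − P p₃ c') + (P p₂ c' − P p₁ c')(P p₄ c − P p₃ c) = 0`, then `det = 0`. -/
theorem det_segMatrix_eq_zero_of_orthogonal_differences {r : ℕ} (P : Fin h → Fin h → ℂ) (p₁ p₂ p₃ p₄ : Fin h)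
    (h12 : p₁ ≠ p₂) (h34 : p₃ ≠ p₄) (h13 : p₁ ≠ p₃) (h14 : p₁ ≠ p₄) (h23 : p₂ ≠ p₃) (h24 : p₂ ≠ p₄)
    (hyp : ∀ j : Fin r, ∀ c ∈ benchCols h r j, ∀ c' ∈ benchCols h r j, c ≠ c' →
      (P p₂ c - P p₁ c) * (P p₄ c' - P p₃ c') + (P p₂ c' - P p₁ c') * (P p₄ c - P p₃ c) = 0)
    (uu : Fin r → Finset (Fin h)) (hsurj : ∀ S : Finset (Fin h), S.card ≤ 2 → ∃ i, uu i = S) :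
    (segMatrix r P uu).det = 0 := by
  classical
  -- we only know the relation on the benchmark columns; that is all the kernel-vector argument uses
  set M := segMatrix r P uu with hM
  have card2 : ∀ p q : Fin h, p ≠ q → ({p, q} : Finset (Fin h)).card ≤ 2 := fun p q hpq => by
    rw [Finset.card_pair hpq]
  obtain ⟨i₁, hi₁⟩ := hsurj {p₁, p₃} (card2 p₁ p₃ h13)
  obtain ⟨i₂, hi₂⟩ := hsurj {p₂, p₄} (card2 p₂ p₄ h24)
  obtain ⟨i₃, hi₃⟩ := hsurj {p₁, p₄} (card2 p₁ p₄ h14)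
  obtain ⟨i₄, hi₄⟩ := hsurj {p₂, p₃} (card2 p₂ p₃ h23)
  have n12 : i₁ ≠ i₂ := by
    intro e; rcases pair_eq_pair_iff p₁ p₃ p₂ p₄ (by rw [← hi₁, ← hi₂, e]) with ⟨h1, _⟩ | ⟨h1, _⟩
    · exact h12 h1
    · exact h14 h1
  have n13 : i₁ ≠ i₃ := by
    intro e; rcases pair_eq_pair_iff p₁ p₃ p₁ p₄ (by rw [← hi₁, ← hi₃, e]) with ⟨_, h2⟩ | ⟨h1, _⟩
    · exact h34 h2
    · exact h14 h1
  have n14 : i₁ ≠ i₄ := by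
    intro e; rcases pair_eq_pair_iff p₁ p₃ p₂ p₃ (by rw [← hi₁, ← hi₄, e]) with ⟨h1, _⟩ | ⟨h1, _⟩
    · exact h12 h1
    · exact h13 h1
  let v : Fin r → ℂ := Pi.single i₁ 1 + Pi.single i₂ 1 - Pi.single i₃ 1 - Pi.single i₄ 1
  have hv0 : v ≠ 0 := by
    intro hv
    have := congr_fun hv i₁
    simp only [v, Pi.add_apply, Pi.sub_apply, Pi.single_eq_same, Pi.single_eq_of_ne n12, Pi.single_eq_of_ne n13,
      Pi.single_eq_of_ne n14, Pi.zero_apply] at this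
    norm_num at this
  have hvM : Matrix.vecMul v M = 0 := by
    funext j
    simp only [v, Matrix.add_vecMul, Matrix.sub_vecMul, Matrix.single_one_vecMul, Pi.add_apply, Pi.sub_apply,
      Matrix.row_apply, Pi.zero_apply]
    rw [hM, segMatrix_row_pair P uu h13 hi₁ j, segMatrix_row_pair P uu h24 hi₂ j, segMatrix_row_pair P uu h14 hi₃ j,
      segMatrix_row_pair P uu h23 hi₄ j]
    have := pairSum_orthogonal_differences P h13 h14 h23 h24 (benchCols h r j) (hyp j)
    linear_combination this
  exact (Matrix.exists_vecMul_eq_zero_iff).mp ⟨v, hv0, hvM⟩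

/-- **Zeon-orthogonal differences — the line's form** (the matrix of `SegmentMeanValueAt h` verbatim). -/
theorem det_eq_zero_of_orthogonal_differences {r : ℕ} (P : Fin h → Fin h → ℂ) (p₁ p₂ p₃ p₄ : Fin h)
    (h12 : p₁ ≠ p₂) (h34 : p₃ ≠ p₄) (h13 : p₁ ≠ p₃) (h14 : p₁ ≠ p₄) (h23 : p₂ ≠ p₃) (h24 : p₂ ≠ p₄)
    (hyp : ∀ j : Fin r, ∀ c ∈ benchCols h r j, ∀ c' ∈ benchCols h r j, c ≠ c' →
      (P p₂ c - P p₁ c) * (P p₄ c' - P p₃ c') + (P p₂ c' - P p₁ c') * (P p₄ c - P p₃ c) = 0)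
    (uu : Fin r → Finset (Fin h)) (hsurj : ∀ S : Finset (Fin h), S.card ≤ 2 → ∃ i, uu i = S) :
    (Matrix.of fun i j : Fin r =>
      ∑ g : (↥(benchCols h r j) → ↥(uu i)), (∏ c : ↥(benchCols h r j), P (g c) c) *
        ∏ a : ↥(uu i), ((Finset.univ.filter fun c : ↥(benchCols h r j) => g c = a).card.factorial : ℂ)).det = 0 :=
  det_segMatrix_eq_zero_of_orthogonal_differences P p₁ p₂ p₃ p₄ h12 h34 h13 h14 h23 h24 hyp uu hsurj

/-- **Corollary (new case): differences on two UNCOUPLED coordinates.**  If two pairs of points differ only in two coordinates `u, v`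
(`P p₂ − P p₁` and `P p₄ − P p₃` vanish outside `{u, v}`) and no benchmark column contains both `u` and `v` (e.g. the top two bits when
`r < 3·2^{k−2}`), the matrix is singular — whatever the four values of the differences. -/
theorem det_eq_zero_of_differences_on_uncoupled_bits {r : ℕ} (P : Fin h → Fin h → ℂ) (p₁ p₂ p₃ p₄ u v : Fin h)
    (h12 : p₁ ≠ p₂) (h34 : p₃ ≠ p₄) (h13 : p₁ ≠ p₃) (h14 : p₁ ≠ p₄) (h23 : p₂ ≠ p₃) (h24 : p₂ ≠ p₄)
    (hδ : ∀ c, c ≠ u → c ≠ v → P p₂ c = P p₁ c) (hδ' : ∀ c, c ≠ u → c ≠ v → P p₄ c = P p₃ c)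
    (huv : ∀ j : Fin r, u ∈ benchCols h r j → v ∉ benchCols h r j)
    (uu : Fin r → Finset (Fin h)) (hsurj : ∀ S : Finset (Fin h), S.card ≤ 2 → ∃ i, uu i = S) :
    (Matrix.of fun i j : Fin r =>
      ∑ g : (↥(benchCols h r j) → ↥(uu i)), (∏ c : ↥(benchCols h r j), P (g c) c) *
        ∏ a : ↥(uu i), ((Finset.univ.filter fun c : ↥(benchCols h r j) => g c = a).card.factorial : ℂ)).det = 0 := by
  refine det_eq_zero_of_orthogonal_differences P p₁ p₂ p₃ p₄ h12 h34 h13 h14 h23 h24 ?_ uu hsurj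
  intro j c hc c' hc' hcc'
  -- at least one of c, c' lies outside {u, v} (they are distinct, and u, v are never together in a column),
  -- so one of the two differences vanishes at that coordinate in each product
  by_cases hcu : c = u
  · subst hcu
    have hc'v : c' ≠ v := fun e => huv j hc (e ▸ hc')
    rw [hδ c' (Ne.symm hcc') hc'v, hδ' c' (Ne.symm hcc') hc'v]; ring
  by_cases hcv : c = v
  · subst hcv
    have hc'u : c' ≠ u := fun e => huv j (e ▸ hc') hc
    rw [hδ c' hc'u (Ne.symm hcc'), hδ' c' hc'u (Ne.symm hcc')]; ring
  rw [hδ c hcu hcv, hδ' c hcu hcv]; ring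

end

end Summit.ValiantsHypothesis.ValiantsHypothesis.Theorems.BarrierLever.ChowBenchmarkHyperplane
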